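import Literature.Barriers.RiemannHypothesis.MollifierLimitationsProofs
import Literature.NumberTheory.Sieve.ContinuousLargeSieve
import Mathlib.Analysis.Distribution.SchwartzSpace.Fourier
import Mathlib.Analysis.Fourier.Inversion
import Mathlib.MeasureTheory.Group.Integral
import HarnessLib

/-!
# Radziwiłł 2012, Proposition A: the inputs (Lemmas 1–4 of §2)

Sibling of `Literature/Barriers/RiemannHypothesis/MollifierLimitationsProofs.lean`, which vendors
**Proposition A** of M. Radziwiłł, *Limitations to mollifying `ζ(s)`* (arXiv:1207.6583) as the
named fact `Literature.Barriers.RiemannHypothesis.Radziwill2012_propA` (one of the three inputs of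
the proved deduction `Radziwill2012_thm1_of_inputs` of Theorem 1). The printed proof of
Proposition A (§3) rests on the four lemmas of §2 ("Key ideas"). This file provides them in the
form the proof consumes:

* **Lemma 1** (Sobolev-type reproducing identity for Dirichlet polynomials) — PROVED
  (`integral_cexp_mul_fourierInv_sub`, one frequency at a time; the printed statement for a
  Dirichlet polynomial `A(s) = Σ_{M ≤ n ≤ N} a(n) n^{-s}` follows by linearity): for a Schwartz
  function `f` and real `ν, u`,
  `∫ e^{-iνt} f̂(t − u) dt = e^{-iνu} f(ν/2π)`, where `f̂(t) = ∫ f(v) e^{2πivt} dv` is the paper's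
  transform (Mathlib's `𝓕⁻ f`); so `A(iu) = ∫ A(it) f̂(t − u) dt` whenever `f(log n/2π) = 1` on the
  support of `A`. The proof is the printed one: Fourier inversion.
* **Lemma 2** (smoothed approximation of `ζ` by a Dirichlet polynomial of length `T^{1+ε}`,
  Bombieri–Friedlander) — NAMED FACT `Radziwill2012_lemma2`. Radziwiłł cites "Proposition 1 in
  Bombieri–Friedlander [Bombieri]"; in the published paper the statement is **Proposition 2**
  (§2, Example 3: "If `x > T^{2A+ε}` then for every fixed `N` and any fixed strip `A ≤ σ ≤ B` we
  have `L(s) = Σ_n a_n n^{-s} v(n/x) + O(T^{-N})`", with `2A = 1` for `ζ`), proved there by Mellin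
  inversion and a contour shift.
* **Lemma 3** (Plancherel bound for `Σ_γ f̂(t − γ)`) and **Lemma 4** (Beurling–Selberg majorant)
  are consumed in §3 only through their combination for a `δ`-well-spaced set `S` and `0 ≤ f ≤ 1`
  supported in an interval `I`:
  `∫_ℝ |Σ_{γ∈S} f̂(t − γ)|² dt ≤ (|I| + 1/δ) · Card S`.
  We PROVE this combination (`integral_norm_sq_sum_fourierInv_sub_le`) from Plancherel for Schwartz
  functions (Mathlib) — which is the printed proof of Lemma 3 — and the classical *continuous large
  sieve inequality* `∫_α^β |Σ_r c_r e(λ_r x)|² dx ≤ (β − α + δ⁻¹) Σ_r |c_r|²` for `δ`-separated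
  real frequencies (Selberg; Vaaler 1985, (1.9); Montgomery–Vaughan 1974, Cor. 2), which the tree
  already PROVES as `Literature.NumberTheory.Sieve.largeSieve_integral`
  (`Literature/NumberTheory/Sieve/ContinuousLargeSieve.lean`); `continuousLargeSieveInequality`
  below is its restatement over a `Finset ℝ` of frequencies. It is exactly what Lemma 4 is used for
  in the paper (p. 5: "for a `δ`-well-spaced set … `Σ_{γ,γ'} K̂(γ − γ') = K̂(0) · Card(S)`",
  `K̂(0) = |I| + 1/δ`). So Lemmas 1, 3 and 4 are theorems here and only Lemma 2 remains a named
  fact.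

Nothing here is specific to `ζ`; the assembly of Proposition A from these inputs (§3) is the
business of a further sibling file.

## Conventions

The paper's `f̂(t) = ∫ f(v) e^{2πivt} dv` (proof of Lemma 3, p. 5) is Mathlib's inverse transform
`𝓕⁻ f`, and `e(x) = e^{2πix}`. Dirichlet polynomials at `s = it` are trigonometric sums
`Σ a(n) e^{-it log n}`, so Lemma 1 is stated for a single frequency `ν` (`= log n`).

## References

* [Radziwill2012] M. Radziwiłł, *Limitations to mollifying ζ(s)*, arXiv:1207.6583 (2012), §2
  (Lemmas 1–4, pp. 4–6 of the arXiv version) and §3.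
* [BombieriFriedlander1995] E. Bombieri, J. B. Friedlander, *Dirichlet polynomial approximations
  to zeta functions*, Ann. Scuola Norm. Sup. Pisa Cl. Sci. (4) 22 (1995), 517–544, §2, Example 3,
  Proposition 2 (p. 522).
* [Vaaler1985] J. D. Vaaler, *Some extremal functions in Fourier analysis*, Bull. Amer. Math. Soc.
  (N.S.) 12 (1985), 183–216, §1, (1.6)–(1.9).
* [MontgomeryVaughan1974] H. L. Montgomery, R. C. Vaughan, *Hilbert's inequality*, J. London
  Math. Soc. (2) 8 (1974), 73–82, Cor. 2.
* [Montgomery1978] H. L. Montgomery, *The analytic principle of the large sieve*, Bull. Amer. Math.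
  Soc. 84 (1978), §6, Corollary 3 (p. 557) — the source of the tree's `largeSieve_integral`.
-/

noncomputable section

open Complex MeasureTheory Real Set SchwartzMap
open scoped FourierTransform ContDiff

namespace Literature.Barriers.RiemannHypothesis

/-! ## Lemma 2: the Bombieri–Friedlander smoothed approximation (named fact) -/

/-- **Radziwiłł 2012, Lemma 2** (Bombieri–Friedlander 1995, Proposition 2 for `ζ`). "There is a
smooth function `w(x)` with `0 ≤ w(x) ≤ 1`, `w(0) = 1`, such that for `T ≤ t ≤ 2T`,
`T₁ = T^{1+ε}`, and any fixed `v > 0`, `ζ(s) = Σ_{n ≤ T₁} n^{-s} · w(n/T₁) + O_v(T^{-v})`."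
Vendored on the critical line `s = ½ + it` (where §3 uses it), with the `O_v` made explicit as
`≤ C · T^{-v}` for `T ≥ T₀`, and with the smooth weight allowed to depend on `ε` and `v` (the
printed weight depends on `ε` only; this form is implied by the printed one).
[cite: Radziwill2012, Lemma 2] [cite: BombieriFriedlander1995, Proposition 2] -/
def Radziwill2012_lemma2 : Prop :=
  ∀ η : ℝ, 0 < η → ∀ v : ℝ, 0 < v →
    ∃ w : ℝ → ℝ, ContDiff ℝ ∞ w ∧ (∀ x, 0 ≤ w x ∧ w x ≤ 1) ∧ w 0 = 1 ∧
      ∃ C T₀ : ℝ, ∀ T : ℝ, T₀ ≤ T → ∀ t ∈ Set.Icc T (2 * T),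
        ‖riemannZeta (1 / 2 + t * I) -
            ∑ n ∈ Finset.Icc 1 ⌊T ^ (1 + η)⌋₊,
              (w (n / T ^ (1 + η)) : ℂ) * (n : ℂ) ^ (-(1 / 2 + t * I))‖ ≤ C * T ^ (-v)

/-! ## Lemmas 3–4: the large sieve input (a theorem of the tree) -/

/-- **The continuous large sieve inequality** (Selberg; Vaaler 1985, (1.9); Montgomery–Vaughan
1974, Cor. 2; Montgomery 1978, §6 Cor. 3): if `λ_1, …, λ_N` are real numbers with
`|λ_n − λ_m| ≥ δ > 0` for `n ≠ m` and `f(x) = Σ_n a(n) e(λ_n x)`, `e(x) = e^{2πix}`, then for every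
interval `[α, β]`, `∫_α^β |f(x)|² dx ≤ (β − α + δ⁻¹) Σ_n |a(n)|²`. This is the tree's
`Literature.NumberTheory.Sieve.largeSieve_integral` (frequencies indexed by a `Fintype`), restated
for a finite set `Λ ⊂ ℝ` of frequencies with coefficients `c : ℝ → ℂ` and the exponential written
out. (Vaaler derives it from Selberg's majorant of `χ_[α,β]` — Radziwiłł's Lemma 4 — by expanding
the square, which is Radziwiłł's Lemma 3.)
[cite: Vaaler1985, (1.9)] [cite: Montgomery1978, §6 Corollary 3, p. 557] -/
theorem continuousLargeSieveInequality (Λ : Finset ℝ) (c : ℝ → ℂ) {δ : ℝ} (hδ : 0 < δ)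
    (hsep : ∀ l ∈ Λ, ∀ l' ∈ Λ, l ≠ l' → δ ≤ |l - l'|) {α β : ℝ} (hαβ : α ≤ β) :
    ∫ x in α..β, ‖∑ l ∈ Λ, c l * cexp (2 * π * I * l * x)‖ ^ 2 ≤
      (β - α + 1 / δ) * ∑ l ∈ Λ, ‖c l‖ ^ 2 := by
  have hsep' : ∀ r s : Λ, r ≠ s → δ ≤ |(r : ℝ) - s| := fun r s hrs ↦
    hsep r r.2 s s.2 fun h ↦ hrs (Subtype.ext h)
  have h := Literature.NumberTheory.Sieve.largeSieve_integral (ι := Λ) (fun l ↦ (l : ℝ)) hδ hsep'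
    (fun l ↦ c l) α (L := β - α) (sub_nonneg.2 hαβ)
  rw [add_sub_cancel, ← one_div] at h
  have hsum : ∀ x : ℝ, ∑ r : Λ, c r * Literature.NumberTheory.Sieve.LargeSieve.e (x * (r : ℝ)) =
      ∑ l ∈ Λ, c l * cexp (2 * π * I * l * x) := by
    intro x
    rw [← Finset.sum_coe_sort Λ (fun l ↦ c l * cexp (2 * π * I * l * x))]
    refine Finset.sum_congr rfl fun r _ ↦ ?_
    rw [Literature.NumberTheory.Sieve.LargeSieve.e_eq_exp]
    congr 2
    push_cast
    ring
  have hsum2 : ∑ r : Λ, ‖c r‖ ^ 2 = ∑ l ∈ Λ, ‖c l‖ ^ 2 := Finset.sum_coe_sort Λ fun l ↦ ‖c l‖ ^ 2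
  simp_rw [hsum] at h
  rwa [hsum2] at h

/-! ## Lemma 1: the reproducing identity (proved) -/

/-- The inverse Fourier transform on `ℝ` as an explicit integral with `mul`:
`𝓕⁻ f w = ∫ e^{2πi v w} f(v) dv` (a restatement of Mathlib's `Real.fourierInv_eq'` /
`Literature.Analysis.FunctionSpaces.fourierInv_real_eq_integral_exp_smul`, kept local to avoid a
heavy import). [folklore] -/
theorem fourierInv_real_eq_integral (f : ℝ → ℂ) (w : ℝ) :
    𝓕⁻ f w = ∫ v : ℝ, cexp (↑(2 * π * v * w) * I) * f v := by
  rw [Real.fourierInv_eq_fourier_neg, Real.fourier_real_eq_integral_exp_smul]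
  congr 1
  funext v
  rw [smul_eq_mul]
  congr 2
  push_cast
  ring

/-- The Fourier transform on `ℝ` as an explicit integral with `mul`:
`𝓕 f w = ∫ e^{-2πi v w} f(v) dv` (definitionally Mathlib's `Real.fourier_real_eq_integral_exp_smul`).
[folklore] -/
theorem fourier_real_eq_integral (f : ℝ → ℂ) (w : ℝ) :
    𝓕 f w = ∫ v : ℝ, cexp (↑(-2 * π * v * w) * I) * f v := by
  rw [Real.fourier_real_eq_integral_exp_smul]
  rfl

/-- **Radziwiłł 2012, Lemma 1** (one frequency). For a Schwartz function `f` on `ℝ` and real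
`ν, u`: `∫ e^{-iνt} f̂(t − u) dt = e^{-iνu} f(ν/2π)`, `f̂ = 𝓕⁻ f`. Consequently, for a Dirichlet
polynomial `A(it) = Σ_n a(n) n^{-it} = Σ_n a(n) e^{-it log n}` and `f` with `f(log n/2π) = 1` on
its support, `A(iu) = ∫ A(it) f̂(t − u) dt` (the printed statement). Proof as printed: substitute
`t = x + u` and apply Fourier inversion `𝓕 (𝓕⁻ f) = f`. [cite: Radziwill2012, Lemma 1] -/
theorem integral_cexp_mul_fourierInv_sub (f : 𝓢(ℝ, ℂ)) (ν u : ℝ) :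
    ∫ t : ℝ, cexp (-(↑(ν * t) * I)) * 𝓕⁻ (f : ℝ → ℂ) (t - u) =
      cexp (-(↑(ν * u) * I)) * f (ν / (2 * π)) := by
  -- substitute `t = x + u`
  have hsub : (fun t : ℝ ↦ cexp (-(↑(ν * t) * I)) * 𝓕⁻ (f : ℝ → ℂ) (t - u)) =
      fun t ↦ (fun x : ℝ ↦ cexp (-(↑(ν * (x + u)) * I)) * 𝓕⁻ (f : ℝ → ℂ) x) (t - u) := by
    funext t
    simp only [sub_add_cancel]
  rw [hsub, integral_sub_right_eq_self (fun x : ℝ ↦ cexp (-(↑(ν * (x + u)) * I)) *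
    𝓕⁻ (f : ℝ → ℂ) x) u]
  have hsplit : ∀ x : ℝ, cexp (-(↑(ν * (x + u)) * I)) * 𝓕⁻ (f : ℝ → ℂ) x =
      cexp (-(↑(ν * u) * I)) * (cexp (↑(-2 * π * x * (ν / (2 * π))) * I) * 𝓕⁻ (f : ℝ → ℂ) x) := by
    intro x
    rw [← mul_assoc, ← Complex.exp_add]
    congr 2
    have hπ : (π : ℂ) ≠ 0 := by exact_mod_cast Real.pi_ne_zero
    push_cast
    field_simp
    ring
  simp_rw [hsplit]
  rw [integral_const_mul, ← fourier_real_eq_integral]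
  -- Fourier inversion for the Schwartz function `f`
  have hinv : 𝓕 (𝓕⁻ (f : ℝ → ℂ)) = (f : ℝ → ℂ) :=
    f.continuous.fourier_fourierInv_eq f.integrable (𝓕 f).integrable
  rw [hinv]

/-! ## Lemmas 3–4 combined: the mean square of `Σ_γ f̂(t − γ)` (proved from the large sieve) -/

/-- A `δ`-separated finite set of reals in an interval `[a, b]` has at most `(b − a)/δ + 1`
elements: `(card S − 1) · δ ≤ b − a`. [folklore] -/
theorem card_sub_one_mul_le_of_separated {S : Finset ℝ} {a b δ : ℝ} (hδ : 0 < δ) (hab : a ≤ b)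
    (hS : ∀ γ ∈ S, γ ∈ Icc a b) (hsep : ∀ γ ∈ S, ∀ γ' ∈ S, γ ≠ γ' → δ ≤ |γ - γ'|) :
    ((S.card : ℝ) - 1) * δ ≤ b - a := by
  -- induction on the cardinality, removing the largest element
  suffices h : ∀ n : ℕ, ∀ (S : Finset ℝ) (b : ℝ), S.card = n → a ≤ b → (∀ γ ∈ S, γ ∈ Icc a b) →
      (∀ γ ∈ S, ∀ γ' ∈ S, γ ≠ γ' → δ ≤ |γ - γ'|) → ((S.card : ℝ) - 1) * δ ≤ b - a from
    h S.card S b rfl hab hS hsep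
  intro n
  induction n with
  | zero =>
    intro S b hcard hab _ _
    rw [hcard]
    simp only [CharP.cast_eq_zero, zero_sub, neg_mul, one_mul, neg_le_sub_iff_le_add]
    linarith
  | succ n ih =>
    intro S b hcard hab hS hsep
    have hne : S.Nonempty := by
      rw [← Finset.card_pos, hcard]; exact Nat.succ_pos n
    set M : ℝ := S.max' hne with hM
    have hMS : M ∈ S := S.max'_mem hne
    have hMb : M ≤ b := (hS M hMS).2
    set S' : Finset ℝ := S.erase M with hS'
    have hcard' : S'.card = n := by rw [Finset.card_erase_of_mem hMS, hcard]; rfl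
    rcases S'.eq_empty_or_nonempty with h0 | hne'
    · -- `S = {M}`
      have : S.card = 1 := by
        have h1 := Finset.card_erase_add_one hMS
        rw [← hS', h0, Finset.card_empty] at h1
        omega
      rw [this]
      simp only [Nat.cast_one, sub_self, zero_mul, sub_nonneg, hab]
    · have hS'sub : ∀ γ ∈ S', γ ∈ Icc a (M - δ) := by
        intro γ hγ
        have hγS : γ ∈ S := Finset.mem_of_mem_erase hγ
        have hγM : γ ≠ M := Finset.ne_of_mem_erase hγ
        have hle : γ ≤ M := S.le_max' γ hγS
        have hsepγ := hsep γ hγS M hMS hγM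
        rw [abs_sub_comm, abs_of_nonneg (by linarith)] at hsepγ
        exact ⟨(hS γ hγS).1, by linarith⟩
      have hab' : a ≤ M - δ := by
        obtain ⟨γ, hγ⟩ := hne'
        exact (hS'sub γ hγ).1.trans (hS'sub γ hγ).2
      have hsep' : ∀ γ ∈ S', ∀ γ' ∈ S', γ ≠ γ' → δ ≤ |γ - γ'| := fun γ hγ γ' hγ' hne ↦
        hsep γ (Finset.mem_of_mem_erase hγ) γ' (Finset.mem_of_mem_erase hγ') hne
      have key := ih S' (M - δ) hcard' hab' hS'sub hsep'
      rw [hcard'] at key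
      rw [hcard]
      push_cast at key ⊢
      nlinarith

/-- **Radziwiłł 2012, Lemmas 3–4 as used in §3.** Let `f` be a Schwartz function on `ℝ` with
`|f| ≤ 1`, vanishing off `[α, β]`, and let `S` be a finite `δ`-well-spaced set of reals. Then
`∫_ℝ |Σ_{γ∈S} f̂(t − γ)|² dt ≤ (β − α + 1/δ) · Card S` (`f̂ = 𝓕⁻ f`). Proof as printed for
Lemma 3: `Σ_γ f̂(t − γ) = 𝓕⁻(f · Σ_γ e(−γ ·))(t)`, so by Plancherel the left side is
`∫ |f(v)|² |Σ_γ e(−γv)|² dv ≤ ∫_α^β |Σ_γ e(−γ v)|² dv`, which the continuous large sieve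
inequality (the role of Lemma 4; the tree's `largeSieve_integral`) bounds by
`(β − α + 1/δ) Card S`. [cite: Radziwill2012, Lemmas 3–4] -/
theorem integral_norm_sq_sum_fourierInv_sub_le
    (f : 𝓢(ℝ, ℂ)) {α β : ℝ} (hαβ : α ≤ β) (hsupp : ∀ x, x ∉ Icc α β → f x = 0)
    (hf1 : ∀ x, ‖f x‖ ≤ 1) (S : Finset ℝ) {δ : ℝ} (hδ : 0 < δ)
    (hsep : ∀ γ ∈ S, ∀ γ' ∈ S, γ ≠ γ' → δ ≤ |γ - γ'|) :
    ∫ t : ℝ, ‖∑ γ ∈ S, 𝓕⁻ (f : ℝ → ℂ) (t - γ)‖ ^ 2 ≤ (β - α + 1 / δ) * S.card := by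
  -- the trigonometric sum `E(v) = Σ_γ e(−γ v)` and the product `g = f · E`
  set E : ℝ → ℂ := fun v ↦ ∑ γ ∈ S, cexp (2 * π * I * (-γ) * v) with hE
  have hofReal : ContDiff ℝ ∞ (fun x : ℝ ↦ (x : ℂ)) := Complex.ofRealCLM.contDiff
  have hEsmooth : ContDiff ℝ ∞ E := by
    simp only [hE]
    apply ContDiff.sum
    intro γ _
    exact Complex.contDiff_exp.comp (contDiff_const.mul hofReal)
  have hEcont : Continuous E := hEsmooth.continuous
  set g : ℝ → ℂ := fun v ↦ f v * E v with hg
  have hgsmooth : ContDiff ℝ ∞ g := (f.smooth ⊤).mul hEsmooth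
  have hgsupp : HasCompactSupport g := by
    apply HasCompactSupport.of_support_subset_isCompact (isCompact_Icc (a := α) (b := β))
    intro v hv
    by_contra hvI
    exact hv (by simp [hg, hsupp v hvI])
  set gS : 𝓢(ℝ, ℂ) := hgsupp.toSchwartzMap hgsmooth with hgS
  have hgS_apply : ∀ v, gS v = f v * E v := fun v ↦ rfl
  -- `𝓕⁻ g (t) = Σ_γ 𝓕⁻ f (t − γ)`
  have hFg : ∀ t : ℝ, 𝓕⁻ (gS : ℝ → ℂ) t = ∑ γ ∈ S, 𝓕⁻ (f : ℝ → ℂ) (t - γ) := by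
    intro t
    rw [fourierInv_real_eq_integral]
    have hterm : ∀ v : ℝ, cexp (↑(2 * π * v * t) * I) * (gS : ℝ → ℂ) v =
        ∑ γ ∈ S, cexp (↑(2 * π * v * (t - γ)) * I) * f v := by
      intro v
      change cexp (↑(2 * π * v * t) * I) * (f v * E v) = _
      simp only [hE, Finset.mul_sum]
      refine Finset.sum_congr rfl fun γ _ ↦ ?_
      rw [mul_comm (f v), ← mul_assoc, ← Complex.exp_add]
      congr 2
      push_cast
      ring
    simp_rw [hterm]
    rw [integral_finsetSum]
    · refine Finset.sum_congr rfl fun γ _ ↦ ?_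
      rw [fourierInv_real_eq_integral]
    · intro γ _
      apply f.integrable.bdd_mul (c := 1)
      · exact (Continuous.aestronglyMeasurable (by fun_prop))
      · filter_upwards with v
        rw [Complex.norm_exp_ofReal_mul_I]
  -- Plancherel for `gS`, transported to `𝓕⁻`
  have hPl : ∫ t : ℝ, ‖𝓕⁻ (gS : ℝ → ℂ) t‖ ^ 2 = ∫ v : ℝ, ‖gS v‖ ^ 2 := by
    have h1 : (fun t : ℝ ↦ ‖𝓕⁻ (gS : ℝ → ℂ) t‖ ^ 2) =
        fun t ↦ (fun s : ℝ ↦ ‖𝓕 (gS : ℝ → ℂ) s‖ ^ 2) (-t) := by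
      funext t
      simp only [Real.fourierInv_eq_fourier_neg]
    rw [h1, integral_neg_eq_self (fun s : ℝ ↦ ‖𝓕 (gS : ℝ → ℂ) s‖ ^ 2) volume]
    have h2 := SchwartzMap.integral_norm_sq_fourier gS
    rw [SchwartzMap.fourier_coe] at h2
    exact h2
  -- `∫ |g|² ≤ ∫_α^β |E|²`
  have hg_le : ∀ v, ‖gS v‖ ^ 2 ≤ (Icc α β).indicator (fun v ↦ ‖E v‖ ^ 2) v := by
    intro v
    rw [hgS_apply, norm_mul, mul_pow]
    by_cases hv : v ∈ Icc α β
    · rw [indicator_of_mem hv]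
      have : ‖f v‖ ^ 2 ≤ 1 := by
        have := hf1 v
        have h0 := norm_nonneg (f v)
        nlinarith
      calc ‖f v‖ ^ 2 * ‖E v‖ ^ 2 ≤ 1 * ‖E v‖ ^ 2 := by gcongr
        _ = ‖E v‖ ^ 2 := one_mul _
    · rw [indicator_of_notMem hv, hsupp v hv]
      simp
  have hEint : IntegrableOn (fun v ↦ ‖E v‖ ^ 2) (Icc α β) :=
    (by fun_prop : Continuous fun v ↦ ‖E v‖ ^ 2).integrableOn_Icc
  have hstep : ∫ v : ℝ, ‖gS v‖ ^ 2 ≤ ∫ v in α..β, ‖E v‖ ^ 2 := by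
    rw [intervalIntegral.integral_of_le hαβ, ← integral_Icc_eq_integral_Ioc,
      ← integral_indicator measurableSet_Icc]
    apply integral_mono _ (hEint.integrable_indicator measurableSet_Icc) hg_le
    have := (gS.memLp 2 volume)
    simpa using this.integrable_norm_pow (by norm_num)
  -- the large sieve for the frequencies `−γ`
  have hLS' : ∫ v in α..β, ‖E v‖ ^ 2 ≤ (β - α + 1 / δ) * S.card := by
    have hinj : Set.InjOn (fun γ : ℝ ↦ -γ) S := fun x _ y _ h ↦ neg_injective h
    have key := continuousLargeSieveInequality (S.image fun γ ↦ -γ) (fun _ ↦ 1) hδ ?_ hαβ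
    · have hsum : ∀ v : ℝ, ∑ l ∈ S.image (fun γ ↦ -γ), (1 : ℂ) * cexp (2 * π * I * l * v) =
          E v := by
        intro v
        rw [Finset.sum_image hinj]
        simp only [hE, one_mul]
        refine Finset.sum_congr rfl fun γ _ ↦ ?_
        push_cast
        ring_nf
      simp_rw [hsum] at key
      rw [Finset.sum_image hinj] at key
      simpa using key
    · intro l hl l' hl' hne
      obtain ⟨γ, hγ, rfl⟩ := Finset.mem_image.1 hl
      obtain ⟨γ', hγ', rfl⟩ := Finset.mem_image.1 hl'
      have : γ ≠ γ' := fun h ↦ hne (by rw [h])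
      have := hsep γ hγ γ' hγ' this
      rwa [show |(-γ) - (-γ')| = |γ - γ'| by rw [abs_sub_comm]; ring_nf] 
  -- assemble
  calc ∫ t : ℝ, ‖∑ γ ∈ S, 𝓕⁻ (f : ℝ → ℂ) (t - γ)‖ ^ 2
      = ∫ t : ℝ, ‖𝓕⁻ (gS : ℝ → ℂ) t‖ ^ 2 := by simp_rw [hFg]
    _ = ∫ v : ℝ, ‖gS v‖ ^ 2 := hPl
    _ ≤ ∫ v in α..β, ‖E v‖ ^ 2 := hstep
    _ ≤ (β - α + 1 / δ) * S.card := hLS'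

end Literature.Barriers.RiemannHypothesis
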